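import Mathlib.Analysis.Calculus.Deriv.MeanValue
import Mathlib.Topology.Order.IntermediateValue
import Mathlib.Topology.Order.Compact
import Literature.Barriers.CriticalPhenomena.WeaklySAWFourDimLogCorrectionsReduction
import Literature.Barriers.CriticalPhenomena.WeaklySAWFourDimLogCorrectionsProofs
import HarnessLib

/-!
# `WeaklySAWFourDimLogCorrections` (BBS 2015, Theorem 1.1): the change of parameters of §4.2,
# proved — Proposition 4.2(ii) from Theorem 4.1 and Lemma A.1

Companion to `WeaklySAWFourDimLogCorrectionsReduction.lean` (Bauerschmidt–Brydges–Slade, CMP 337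
(2015), arXiv:1403.7422), which proves Theorem 1.1 (`CTWSAW.BBS2015_thm11`, the barrier
`WeaklySAWFourDimLogCorrections`) from four named facts: Theorem 4.1 (`BBS2015_thm41`),
Proposition 4.2(ii) relative to Theorem 4.1's data (`BBS2015_prop42ii`), a part of Lemma 2.1
(`BBS2015_lem21`) and (1.8) (`BBS2015_eq18`). This file DISCHARGES the second of these relative to
Lemma A.1 (`CTWSAW.BBS2015_lemA1` of the barrier file): `BBS2015_prop42ii_of_lemA1`, by formalising
the source's proof of Proposition 4.2 ("the construction of the maps … involves only elementary
calculus"; the identification of the critical point uses `χ(g,ν*) = (1+z₀*)/m²` and `χ ↑ ∞`).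
Consequently Theorem 1.1 follows from Theorem 4.1, Lemma A.1, Lemma 2.1 (part) and (1.8)
(`BBS2015_thm11_of_thm41_of_lemA1`), all of them statements printed in the source about the
objects of the barrier file.

## Contents (namespace `Literature.Barriers.CriticalPhenomena.CTWSAW`)

* `Thm41Data.abs_z₀c_le`, `Thm41Data.abs_ν₀c_le` — `|z₀ᶜ(m²,g₀)|, |ν₀ᶜ(m²,g₀)| ≤ Kg₀` (mean value
  theorem from `z₀ᶜ(m²,0) = ν₀ᶜ(m²,0) = 0` and the `O(1)` derivative bounds).
* `sFun` (`s(m²,g₀) = g₀/(1+z₀ᶜ(m²,g₀))²`), `gStar` (`g_* = min(δ/2, 1/(8K+8))`, so `Kg₀ ≤ 1/8`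
  and `1 + z₀ᶜ ∈ [7/8, 9/8]` on `[0,g_*]`), `Thm41Data.sFun_sub_ge` (the printed
  "`|s(m²,u) - s(m²,v)| ≥ (1 - O(g_*))|u - v|`", here with constant `1/4`), `gRoot` (`g₀*(m²,g)`,
  the inverse of `s(m², ·)` on `[0,g_*]`, for `g ∈ [0, g_*/2]`, by the intermediate value theorem)
  and its continuity in `m²`, `nuStar` (`ν*(m²,g)`) and its continuity,
  `Thm41Data.susceptibility_nuStar` (`χ(g, ν*(m²,g)) = (1 + z₀*)/m²`),
  `Thm41Data.criticalNu_lt_nuStar` (`ν* > ν_c` for `m² > 0`, via Lemma A.1),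
  `Thm41Data.nuStar_zero` (`ν*(0,g) = ν_c(g)`); the primed versions
  `Thm41Data.criticalNu_lt_nuStar'`, `Thm41Data.nuStar_zero'` take as hypothesis only the clause
  of Lemma A.1 that the proof uses, `χ(g,ν) < ∞ ↔ ν > ν_c(g)` at `d = 4` for the `g` at hand.
* `BBS2015_prop42ii_of_lt_top_iff` — Proposition 4.2(ii) from that clause alone
  (`∀ g > 0, ∀ ν, χ(g,ν) < ∞ ↔ ν_c(g) < ν` at `d = 4`): `m̃²(g,ε) = inf{m² ∈ [0,δ/2] : ν*(m²,g) =
  ν_c(g) + ε}` (nonempty for `0 ≤ ε < ε₁(g) = ν*(δ/2,g) - ν_c(g)` by the intermediate value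
  theorem, attained by closedness), `m̃² → 0` as `ε ↓ 0` (the minimum of `ν*(·,g) - ν_c(g)` on
  `[η, δ/2]` is positive), `g̃₀ = g₀*(m̃², g)`, and the bounds `g̃₀ = g + O(g²)`,
  `ν̃₀, z̃₀ = O(g)` with the explicit constant `5K + 1`; `BBS2015_prop42ii_of_lemA1` — the same
  from Lemma A.1 (`BBS2015_lemA1`), which contains that clause. (The clause itself is proved in
  `WeaklySAWSubmultiplicativity.lean`, `susceptibility_lt_top_iff`, downstream of this file's
  imports; the unconditional `BBS2015_prop42ii_holds` is assembled in
  `WeaklySAWFourDimLogCorrectionsCesaroAssembly.lean`.)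
* `BBS2015_thm11_of_thm41_of_lemA1`, `weaklySAWFourDimLogCorrections_of_thm41_of_lemA1`.

Monotonicity of `χ` in `ν` is `susceptibility_antitone` of `WeaklySAWFourDimLogCorrectionsProofs`.
Locators: Proposition 4.2 and its proof (§4.2) by name and display content.
-/

noncomputable section

open MeasureTheory Filter Topology Set
open Literature.Probability.LatticeModels
open scoped ENNReal BigOperators

namespace Literature.Barriers.CriticalPhenomena

namespace CTWSAW

section ChangeOfParameters

variable {δ K : ℝ} {ν₀c z₀c : ℝ → ℝ → ℝ} {c : ℝ → ℝ}

namespace Thm41Data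

/-- The `O(1)` constant of Theorem 4.1 is nonnegative. [cite: BauerschmidtBrydgesSlade2015LogCorr, Theorem 4.1] -/
theorem K_nonneg (hD : Thm41Data δ K ν₀c z₀c c) : 0 ≤ K :=
  (abs_nonneg _).trans
    (hD.deriv_z₀c 0 ⟨le_rfl, hD.pos⟩ (δ / 2) ⟨by linarith [hD.pos], by linarith [hD.pos]⟩)

/-- `g₀ ↦ z₀ᶜ(m², g₀)` is continuous on `[0,δ)`. [cite: BauerschmidtBrydgesSlade2015LogCorr, Theorem 4.1] -/
theorem continuousOn_z₀c_right (hD : Thm41Data δ K ν₀c z₀c c) {m2 : ℝ} (hm2 : m2 ∈ Ico 0 δ) :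
    ContinuousOn (z₀c m2) (Ico 0 δ) :=
  hD.cont_z₀c.comp (continuousOn_const.prodMk continuousOn_id) fun _ hg₀ => ⟨hm2, hg₀⟩

/-- `g₀ ↦ ν₀ᶜ(m², g₀)` is continuous on `[0,δ)`. [cite: BauerschmidtBrydgesSlade2015LogCorr, Theorem 4.1] -/
theorem continuousOn_ν₀c_right (hD : Thm41Data δ K ν₀c z₀c c) {m2 : ℝ} (hm2 : m2 ∈ Ico 0 δ) :
    ContinuousOn (ν₀c m2) (Ico 0 δ) :=
  hD.cont_ν₀c.comp (continuousOn_const.prodMk continuousOn_id) fun _ hg₀ => ⟨hm2, hg₀⟩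

/-- Mean-value bound: `|z₀ᶜ(m², v) - z₀ᶜ(m², u)| ≤ K(v - u)` for `0 ≤ u ≤ v < δ`.
[cite: BauerschmidtBrydgesSlade2015LogCorr, Theorem 4.1 (z₀ᶜ derivative O(1))] -/
theorem abs_z₀c_sub_le (hD : Thm41Data δ K ν₀c z₀c c) {m2 u v : ℝ} (hm2 : m2 ∈ Ico 0 δ)
    (hu : 0 ≤ u) (huv : u ≤ v) (hv : v < δ) : |z₀c m2 v - z₀c m2 u| ≤ K * (v - u) := by
  rcases huv.eq_or_lt with rfl | hlt
  · simp
  have hcont : ContinuousOn (z₀c m2) (Icc u v) :=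
    (hD.continuousOn_z₀c_right hm2).mono fun x hx => ⟨hu.trans hx.1, hx.2.trans_lt hv⟩
  have hder : ∀ x ∈ Ioo u v, HasDerivAt (z₀c m2) (deriv (z₀c m2) x) x := fun x hx =>
    ((hD.diff_z₀c m2 hm2).differentiableAt (Ioo_mem_nhds (hu.trans_lt hx.1) (hx.2.trans hv)))
      |>.hasDerivAt
  obtain ⟨ξ, hξ, hξeq⟩ := exists_hasDerivAt_eq_slope (z₀c m2) (deriv (z₀c m2)) hlt hcont hder
  have hb := hD.deriv_z₀c m2 hm2 ξ ⟨hu.trans_lt hξ.1, hξ.2.trans hv⟩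
  rwa [hξeq, abs_div, abs_of_pos (sub_pos.2 hlt), div_le_iff₀ (sub_pos.2 hlt)] at hb

/-- Mean-value bound: `|ν₀ᶜ(m², v) - ν₀ᶜ(m², u)| ≤ K(v - u)` for `0 ≤ u ≤ v < δ`.
[cite: BauerschmidtBrydgesSlade2015LogCorr, Theorem 4.1 (ν₀ᶜ derivative O(1))] -/
theorem abs_ν₀c_sub_le (hD : Thm41Data δ K ν₀c z₀c c) {m2 u v : ℝ} (hm2 : m2 ∈ Ico 0 δ)
    (hu : 0 ≤ u) (huv : u ≤ v) (hv : v < δ) : |ν₀c m2 v - ν₀c m2 u| ≤ K * (v - u) := by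
  rcases huv.eq_or_lt with rfl | hlt
  · simp
  have hcont : ContinuousOn (ν₀c m2) (Icc u v) :=
    (hD.continuousOn_ν₀c_right hm2).mono fun x hx => ⟨hu.trans hx.1, hx.2.trans_lt hv⟩
  have hder : ∀ x ∈ Ioo u v, HasDerivAt (ν₀c m2) (deriv (ν₀c m2) x) x := fun x hx =>
    ((hD.diff_ν₀c m2 hm2).differentiableAt (Ioo_mem_nhds (hu.trans_lt hx.1) (hx.2.trans hv)))
      |>.hasDerivAt
  obtain ⟨ξ, hξ, hξeq⟩ := exists_hasDerivAt_eq_slope (ν₀c m2) (deriv (ν₀c m2)) hlt hcont hder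
  have hb := hD.deriv_ν₀c m2 hm2 ξ ⟨hu.trans_lt hξ.1, hξ.2.trans hv⟩
  rwa [hξeq, abs_div, abs_of_pos (sub_pos.2 hlt), div_le_iff₀ (sub_pos.2 hlt)] at hb

/-- `|z₀ᶜ(m², g₀)| ≤ Kg₀` on `[0,δ)²`. [cite: BauerschmidtBrydgesSlade2015LogCorr, Theorem 4.1] -/
theorem abs_z₀c_le (hD : Thm41Data δ K ν₀c z₀c c) {m2 g₀ : ℝ} (hm2 : m2 ∈ Ico 0 δ)
    (hg₀ : g₀ ∈ Ico 0 δ) : |z₀c m2 g₀| ≤ K * g₀ := by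
  have h := hD.abs_z₀c_sub_le hm2 le_rfl hg₀.1 hg₀.2
  rwa [hD.z₀c_zero m2 hm2, sub_zero, sub_zero] at h

/-- `|ν₀ᶜ(m², g₀)| ≤ Kg₀` on `[0,δ)²`. [cite: BauerschmidtBrydgesSlade2015LogCorr, Theorem 4.1] -/
theorem abs_ν₀c_le (hD : Thm41Data δ K ν₀c z₀c c) {m2 g₀ : ℝ} (hm2 : m2 ∈ Ico 0 δ)
    (hg₀ : g₀ ∈ Ico 0 δ) : |ν₀c m2 g₀| ≤ K * g₀ := by
  have h := hD.abs_ν₀c_sub_le hm2 le_rfl hg₀.1 hg₀.2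
  rwa [hD.ν₀c_zero m2 hm2, sub_zero, sub_zero] at h

end Thm41Data

/-! ### The map `s(m², g₀) = g₀/(1 + z₀ᶜ(m², g₀))²` and its inverse `g₀*` -/

/-- `s(m², g₀) = g₀/(1 + z₀ᶜ(m², g₀))²` (proof of Proposition 4.2(i), first display).
[cite: BauerschmidtBrydgesSlade2015LogCorr, Proposition 4.2 (proof of (i))] -/
def sFun (z₀c : ℝ → ℝ → ℝ) (m2 g₀ : ℝ) : ℝ := g₀ / (1 + z₀c m2 g₀) ^ 2

/-- The range `[0, g_*]` on which `s(m², ·)` is inverted: `g_* = min(δ/2, 1/(8K+8))`, so that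
`Kg₀ ≤ 1/8` there. [cite: BauerschmidtBrydgesSlade2015LogCorr, Proposition 4.2 (proof of (i), g_*)] -/
def gStar (δ K : ℝ) : ℝ := min (δ / 2) (1 / (8 * K + 8))

namespace Thm41Data

/-- `g_* > 0`. [cite: BauerschmidtBrydgesSlade2015LogCorr, Proposition 4.2 (proof of (i), g_*)] -/
theorem gStar_pos (hD : Thm41Data δ K ν₀c z₀c c) : 0 < gStar δ K := by
  have := hD.K_nonneg
  unfold gStar
  exact lt_min (by linarith [hD.pos]) (by positivity)

/-- `g_* < δ`. [cite: BauerschmidtBrydgesSlade2015LogCorr, Proposition 4.2 (proof of (i), g_*)] -/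
theorem gStar_lt_delta (hD : Thm41Data δ K ν₀c z₀c c) : gStar δ K < δ :=
  (min_le_left _ _).trans_lt (by linarith [hD.pos])

/-- `Kg₀ ≤ 1/8` for `g₀ ≤ g_*`. [cite: BauerschmidtBrydgesSlade2015LogCorr, Proposition 4.2 (proof of (i))] -/
theorem K_mul_le_of_le_gStar (hD : Thm41Data δ K ν₀c z₀c c) {g₀ : ℝ} (hg₀ : 0 ≤ g₀)
    (hle : g₀ ≤ gStar δ K) : K * g₀ ≤ 1 / 8 := by
  have hK := hD.K_nonneg
  have h1 : g₀ ≤ 1 / (8 * K + 8) := hle.trans (min_le_right _ _)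
  rw [le_div_iff₀ (by positivity)] at h1
  nlinarith

/-- On `[0, g_*]`, `1 + z₀ᶜ ∈ [7/8, 9/8]`. [cite: BauerschmidtBrydgesSlade2015LogCorr, Proposition 4.2 (proof of (i))] -/
theorem one_add_z₀c_mem (hD : Thm41Data δ K ν₀c z₀c c) {m2 g₀ : ℝ} (hm2 : m2 ∈ Ico 0 δ)
    (hg₀ : 0 ≤ g₀) (hle : g₀ ≤ gStar δ K) :
    7 / 8 ≤ 1 + z₀c m2 g₀ ∧ 1 + z₀c m2 g₀ ≤ 9 / 8 := by
  have h := abs_le.1 ((hD.abs_z₀c_le hm2 ⟨hg₀, hle.trans_lt hD.gStar_lt_delta⟩).trans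
    (hD.K_mul_le_of_le_gStar hg₀ hle))
  constructor <;> linarith [h.1, h.2]

/-- Lower Lipschitz bound of `s(m², ·)` on `[0, g_*]`: `s(v) - s(u) ≥ (v - u)/4` for `u ≤ v`
("`s` is a strictly increasing continuous function of `g₀ ∈ [0,g_*)` such that
`|s(m²,u) - s(m²,v)| ≥ (1 - O(g_*))|u - v|`").
[cite: BauerschmidtBrydgesSlade2015LogCorr, Proposition 4.2 (proof of (i))] -/
theorem sFun_sub_ge (hD : Thm41Data δ K ν₀c z₀c c) {m2 u v : ℝ} (hm2 : m2 ∈ Ico 0 δ)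
    (hu : 0 ≤ u) (huv : u ≤ v) (hv : v ≤ gStar δ K) :
    (v - u) / 4 ≤ sFun z₀c m2 v - sFun z₀c m2 u := by
  have hK := hD.K_nonneg
  obtain ⟨ha1, ha2⟩ := hD.one_add_z₀c_mem hm2 hu (huv.trans hv)
  obtain ⟨hb1, hb2⟩ := hD.one_add_z₀c_mem hm2 (hu.trans huv) hv
  set a := 1 + z₀c m2 u with ha
  set b := 1 + z₀c m2 v with hb
  have hab : |a - b| ≤ K * (v - u) := by
    have h := hD.abs_z₀c_sub_le hm2 hu huv (hv.trans_lt hD.gStar_lt_delta)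
    rw [abs_sub_comm] at h
    simpa [ha, hb] using h
  have huK : K * u ≤ 1 / 8 := hD.K_mul_le_of_le_gStar hu (huv.trans hv)
  -- numerator bound: `(9/20)(v-u) ≤ v a² - u b²`
  have hvu : 0 ≤ v - u := sub_nonneg.2 huv
  have hnum : 9 / 20 * (v - u) ≤ v * a ^ 2 - u * b ^ 2 := by
    have h1 : v * a ^ 2 - u * b ^ 2 = (v - u) * a ^ 2 + u * ((a - b) * (a + b)) := by ring
    have h2 : -(K * (v - u) * (9 / 4)) ≤ (a - b) * (a + b) := by
      have hab' := (abs_le.1 hab).1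
      nlinarith [hab', abs_nonneg (a - b), (abs_le.1 hab).2]
    have h3 : u * ((a - b) * (a + b)) ≥ -(u * (K * (v - u) * (9 / 4))) := by
      have := mul_le_mul_of_nonneg_left h2 hu
      linarith
    have h4 : u * (K * (v - u) * (9 / 4)) ≤ (9 / 32) * (v - u) := by
      have huK' : u * K ≤ 1 / 8 := by linarith
      have := mul_le_mul_of_nonneg_right huK' (by positivity : (0:ℝ) ≤ (v - u) * (9 / 4))
      linarith
    have ha_sq : (49 : ℝ) / 64 ≤ a ^ 2 := by nlinarith
    have h5 : (49 / 64) * (v - u) ≤ (v - u) * a ^ 2 := by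
      have := mul_le_mul_of_nonneg_left ha_sq hvu
      linarith
    rw [h1]
    linarith
  have hden : a ^ 2 * b ^ 2 ≤ 13 / 8 := by
    have ha_sq : a ^ 2 ≤ 81 / 64 := by nlinarith
    have hb_sq : b ^ 2 ≤ 81 / 64 := by nlinarith
    have := mul_le_mul ha_sq hb_sq (sq_nonneg b) (by norm_num)
    linarith
  have hden_pos : 0 < a ^ 2 * b ^ 2 := by positivity
  have hs : sFun z₀c m2 v - sFun z₀c m2 u = (v * a ^ 2 - u * b ^ 2) / (a ^ 2 * b ^ 2) := by
    simp only [sFun, ← ha, ← hb]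
    field_simp
  rw [hs, le_div_iff₀ hden_pos]
  have := mul_le_mul_of_nonneg_left hden (by positivity : (0:ℝ) ≤ (v - u) / 4)
  linarith

/-- `s(m², 0) = 0`. [cite: BauerschmidtBrydgesSlade2015LogCorr, Proposition 4.2 (proof of (i))] -/
theorem sFun_zero (z₀c : ℝ → ℝ → ℝ) (m2 : ℝ) : sFun z₀c m2 0 = 0 := by simp [sFun]

/-- `s(m², g_*) ≥ g_*/2`. [cite: BauerschmidtBrydgesSlade2015LogCorr, Proposition 4.2 (proof of (i))] -/
theorem half_gStar_le_sFun (hD : Thm41Data δ K ν₀c z₀c c) {m2 : ℝ} (hm2 : m2 ∈ Ico 0 δ) :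
    gStar δ K / 2 ≤ sFun z₀c m2 (gStar δ K) := by
  obtain ⟨hb1, hb2⟩ := hD.one_add_z₀c_mem hm2 hD.gStar_pos.le le_rfl
  have hg := hD.gStar_pos
  unfold sFun
  rw [div_le_div_iff₀ (by norm_num : (0:ℝ) < 2) (by positivity)]
  have hsq : (1 + z₀c m2 (gStar δ K)) ^ 2 ≤ 81 / 64 := by nlinarith
  nlinarith [mul_le_mul_of_nonneg_left hsq hg.le]

/-- `s` is continuous on `[0,δ) × [0, g_*]`. [cite: BauerschmidtBrydgesSlade2015LogCorr, Proposition 4.2 (proof of (i))] -/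
theorem continuousOn_sFun (hD : Thm41Data δ K ν₀c z₀c c) :
    ContinuousOn (fun p : ℝ × ℝ => sFun z₀c p.1 p.2) (Ico 0 δ ×ˢ Icc 0 (gStar δ K)) := by
  have hsub : Ico 0 δ ×ˢ Icc 0 (gStar δ K) ⊆ Ico 0 δ ×ˢ Ico 0 δ :=
    prod_mono le_rfl (Icc_subset_Ico_right hD.gStar_lt_delta)
  refine ContinuousOn.div continuousOn_snd ((continuousOn_const.add (hD.cont_z₀c.mono hsub)).pow 2)
    fun p hp => ?_
  have := (hD.one_add_z₀c_mem hp.1 hp.2.1 hp.2.2).1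
  positivity

/-- Existence of a root of `s(m², ·) = g` in `[0, g_*]` for `g ∈ [0, g_*/2]` (intermediate value
theorem). [cite: BauerschmidtBrydgesSlade2015LogCorr, Proposition 4.2 (proof of (i))] -/
theorem exists_root (hD : Thm41Data δ K ν₀c z₀c c) {m2 : ℝ} (hm2 : m2 ∈ Ico 0 δ) {g : ℝ}
    (hg : g ∈ Icc 0 (gStar δ K / 2)) : ∃ r ∈ Icc 0 (gStar δ K), sFun z₀c m2 r = g := by
  have hcont : ContinuousOn (sFun z₀c m2) (Icc 0 (gStar δ K)) :=
    hD.continuousOn_sFun.comp (continuousOn_const.prodMk continuousOn_id) fun r hr => ⟨hm2, hr⟩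
  have hivt := intermediate_value_Icc hD.gStar_pos.le hcont
  have hmem : g ∈ Icc (sFun z₀c m2 0) (sFun z₀c m2 (gStar δ K)) := by
    rw [sFun_zero]
    exact ⟨hg.1, hg.2.trans (hD.half_gStar_le_sFun hm2)⟩
  obtain ⟨r, hr, hreq⟩ := hivt hmem
  exact ⟨r, hr, hreq⟩

/-- `|r - r'| ≤ 4|s(m², r) - s(m², r')|` on `[0, g_*]`: `s(m², ·)` is injective with Lipschitz
inverse. [cite: BauerschmidtBrydgesSlade2015LogCorr, Proposition 4.2 (proof of (i))] -/
theorem abs_sub_le_four_mul (hD : Thm41Data δ K ν₀c z₀c c) {m2 : ℝ} (hm2 : m2 ∈ Ico 0 δ)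
    {r r' : ℝ} (hr : r ∈ Icc 0 (gStar δ K)) (hr' : r' ∈ Icc 0 (gStar δ K)) :
    |r - r'| ≤ 4 * |sFun z₀c m2 r - sFun z₀c m2 r'| := by
  rcases le_total r r' with h | h
  · have := hD.sFun_sub_ge hm2 hr.1 h hr'.2
    rw [abs_of_nonpos (by linarith), abs_of_nonpos (by linarith)]
    linarith
  · have := hD.sFun_sub_ge hm2 hr'.1 h hr.2
    rw [abs_of_nonneg (by linarith), abs_of_nonneg (by linarith)]
    linarith

end Thm41Data

/-- `g₀*(m², g)`: the root of `s(m², ·) = g` in `[0, g_*]`, for `m² ∈ [0,δ)`, `g ∈ [0, g_*/2]`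
(junk value `0` elsewhere). [cite: BauerschmidtBrydgesSlade2015LogCorr, Proposition 4.2(i) (g₀*)] -/
def gRoot (hD : Thm41Data δ K ν₀c z₀c c) (m2 g : ℝ) : ℝ :=
  if h : m2 ∈ Ico 0 δ ∧ g ∈ Icc 0 (gStar δ K / 2) then (hD.exists_root h.1 h.2).choose else 0

/-- `ν*(m², g) = (ν₀*(m²,g) + m²)/(1 + z₀*(m²,g))` with `ν₀* = ν₀ᶜ(m², g₀*)`, `z₀* = z₀ᶜ(m², g₀*)`.
[cite: BauerschmidtBrydgesSlade2015LogCorr, Proposition 4.2(i) (ν*)] -/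
def nuStar (hD : Thm41Data δ K ν₀c z₀c c) (m2 g : ℝ) : ℝ :=
  (ν₀c m2 (gRoot hD m2 g) + m2) / (1 + z₀c m2 (gRoot hD m2 g))

namespace Thm41Data

/-- Defining property of `g₀*`: `g₀*(m²,g) ∈ [0,g_*]` and `s(m², g₀*(m²,g)) = g`.
[cite: BauerschmidtBrydgesSlade2015LogCorr, Proposition 4.2(i) (g₀*)] -/
theorem gRoot_spec (hD : Thm41Data δ K ν₀c z₀c c) {m2 g : ℝ} (hm2 : m2 ∈ Ico 0 δ)
    (hg : g ∈ Icc 0 (gStar δ K / 2)) :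
    gRoot hD m2 g ∈ Icc 0 (gStar δ K) ∧ sFun z₀c m2 (gRoot hD m2 g) = g := by
  simp only [gRoot, dif_pos (And.intro hm2 hg)]
  exact (hD.exists_root hm2 hg).choose_spec

/-- `g₀*(m², g) > 0` for `g > 0`. [cite: BauerschmidtBrydgesSlade2015LogCorr, Proposition 4.2(i) (g₀*)] -/
theorem gRoot_pos (hD : Thm41Data δ K ν₀c z₀c c) {m2 g : ℝ} (hm2 : m2 ∈ Ico 0 δ)
    (hg : g ∈ Ioc 0 (gStar δ K / 2)) : 0 < gRoot hD m2 g := by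
  obtain ⟨hr, hs⟩ := hD.gRoot_spec hm2 ⟨hg.1.le, hg.2⟩
  rcases hr.1.eq_or_lt with h | h
  · exfalso
    rw [← h, sFun_zero] at hs
    linarith [hg.1]
  · exact h

/-- `g₀*(·, g)` is continuous on `[0,δ)`. [cite: BauerschmidtBrydgesSlade2015LogCorr, Proposition 4.2(i)] -/
theorem continuousOn_gRoot (hD : Thm41Data δ K ν₀c z₀c c) {g : ℝ} (hg : g ∈ Icc 0 (gStar δ K / 2)) :
    ContinuousOn (fun m2 => gRoot hD m2 g) (Ico 0 δ) := by
  intro m₀ hm₀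
  rw [Metric.continuousWithinAt_iff]
  intro ε hε
  obtain ⟨hr₀, hs₀⟩ := hD.gRoot_spec hm₀ hg
  have hc : ContinuousWithinAt (fun m => sFun z₀c m (gRoot hD m₀ g)) (Ico 0 δ) m₀ :=
    (hD.continuousOn_sFun.comp (continuousOn_id.prodMk continuousOn_const)
      (fun m hm => ⟨hm, hr₀⟩)) m₀ hm₀
  obtain ⟨η, hη, hclose⟩ := Metric.continuousWithinAt_iff.1 hc (ε / 8) (by positivity)
  refine ⟨η, hη, fun m hm hdist => ?_⟩
  obtain ⟨hr, hs⟩ := hD.gRoot_spec hm hg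
  have h1 := hD.abs_sub_le_four_mul hm hr hr₀
  rw [hs] at h1
  have h2 := hclose hm hdist
  rw [Real.dist_eq] at h2 ⊢
  calc |gRoot hD m g - gRoot hD m₀ g| ≤ 4 * |g - sFun z₀c m (gRoot hD m₀ g)| := h1
    _ = 4 * |sFun z₀c m (gRoot hD m₀ g) - sFun z₀c m₀ (gRoot hD m₀ g)| := by
        rw [hs₀, abs_sub_comm]
    _ < ε := by linarith

/-- `ν*(·, g)` is continuous on `[0,δ)`. [cite: BauerschmidtBrydgesSlade2015LogCorr, Proposition 4.2(i)] -/
theorem continuousOn_nuStar (hD : Thm41Data δ K ν₀c z₀c c) {g : ℝ} (hg : g ∈ Icc 0 (gStar δ K / 2)) :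
    ContinuousOn (fun m2 => nuStar hD m2 g) (Ico 0 δ) := by
  have hpair : ContinuousOn (fun m2 => (m2, gRoot hD m2 g)) (Ico 0 δ) :=
    continuousOn_id.prodMk (hD.continuousOn_gRoot hg)
  have hmaps : MapsTo (fun m2 => (m2, gRoot hD m2 g)) (Ico 0 δ) (Ico 0 δ ×ˢ Ico 0 δ) := fun m hm =>
    ⟨hm, (hD.gRoot_spec hm hg).1.1, (hD.gRoot_spec hm hg).1.2.trans_lt hD.gStar_lt_delta⟩
  have hν : ContinuousOn (fun m2 => ν₀c m2 (gRoot hD m2 g)) (Ico 0 δ) := hD.cont_ν₀c.comp hpair hmaps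
  have hz : ContinuousOn (fun m2 => z₀c m2 (gRoot hD m2 g)) (Ico 0 δ) := hD.cont_z₀c.comp hpair hmaps
  refine (hν.add continuousOn_id).div (continuousOn_const.add hz) fun m hm => ?_
  have := (hD.one_add_z₀c_mem hm (hD.gRoot_spec hm hg).1.1 (hD.gRoot_spec hm hg).1.2).1
  exact ne_of_gt (by linarith)

/-- The identity `χ(g, ν*(m², g)) = (1 + z₀*)χ̂ = (1 + z₀*)/m²` (from the first display of
Theorem 4.1 and `χ = (1+z₀)χ̂`). [cite: BauerschmidtBrydgesSlade2015LogCorr, Proposition 4.2 (proof of (i), display χ(g,ν*) = (1+z₀*)/m²)] -/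
theorem susceptibility_nuStar (hD : Thm41Data δ K ν₀c z₀c c) {m2 g : ℝ} (hm2 : m2 ∈ Ioo 0 δ)
    (hg : g ∈ Ioc 0 (gStar δ K / 2)) :
    (susceptibility 4 g (nuStar hD m2 g)).toReal = (1 + z₀c m2 (gRoot hD m2 g)) / m2 := by
  have hm2' : m2 ∈ Ico 0 δ := ⟨hm2.1.le, hm2.2⟩
  obtain ⟨hr, hs⟩ := hD.gRoot_spec hm2' ⟨hg.1.le, hg.2⟩
  have hrpos := hD.gRoot_pos hm2' hg
  have h := hD.chiHat_eq m2 hm2 (gRoot hD m2 g) ⟨hrpos, hr.2.trans_lt hD.gStar_lt_delta⟩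
  have hz := (hD.one_add_z₀c_mem hm2' hr.1 hr.2).1
  have hzne : 1 + z₀c m2 (gRoot hD m2 g) ≠ 0 := by linarith
  simp only [chiHat] at h
  have hs' : gRoot hD m2 g / (1 + z₀c m2 (gRoot hD m2 g)) ^ 2 = g := hs
  rw [hs', div_eq_iff hzne] at h
  simp only [nuStar]
  rw [h]
  field_simp

/-- `ν*(m², g) > ν_c(g)` for `m² > 0` ("`χ(g, ν*(m²,g)) < ∞` if `m² > 0` and therefore
`ν*(m², g) > ν_c(g)`"), relative to the clause `χ(g,ν) < ∞ ↔ ν > ν_c(g)` of Lemma A.1 for this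
`g` (the only input from Lemma A.1 that the proof of Proposition 4.2 uses).
[cite: BauerschmidtBrydgesSlade2015LogCorr, Proposition 4.2 (proof of (i)) and Lemma A.1] -/
theorem criticalNu_lt_nuStar' (hD : Thm41Data δ K ν₀c z₀c c) {m2 g : ℝ}
    (hiff : ∀ ν : ℝ, susceptibility 4 g ν < ∞ ↔ criticalNu 4 g < ν)
    (hm2 : m2 ∈ Ioo 0 δ) (hg : g ∈ Ioc 0 (gStar δ K / 2)) : criticalNu 4 g < nuStar hD m2 g := by
  have h := hD.susceptibility_nuStar hm2 hg
  have hr := (hD.gRoot_spec ⟨hm2.1.le, hm2.2⟩ ⟨hg.1.le, hg.2⟩).1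
  have hz := (hD.one_add_z₀c_mem ⟨hm2.1.le, hm2.2⟩ hr.1 hr.2).1
  have hpos : 0 < (susceptibility 4 g (nuStar hD m2 g)).toReal := by
    rw [h]
    exact div_pos (by linarith) hm2.1
  exact (hiff _).1 (ENNReal.toReal_pos_iff.1 hpos).2

/-- `ν*(m², g) > ν_c(g)` for `m² > 0` ("`χ(g, ν*(m²,g)) < ∞` if `m² > 0` and therefore
`ν*(m², g) > ν_c(g)`"; the strictness is Lemma A.1, `χ < ∞ ↔ ν > ν_c`).
[cite: BauerschmidtBrydgesSlade2015LogCorr, Proposition 4.2 (proof of (i))] -/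
theorem criticalNu_lt_nuStar (hD : Thm41Data δ K ν₀c z₀c c) (hA : BBS2015_lemA1) {m2 g : ℝ}
    (hm2 : m2 ∈ Ioo 0 δ) (hg : g ∈ Ioc 0 (gStar δ K / 2)) : criticalNu 4 g < nuStar hD m2 g :=
  hD.criticalNu_lt_nuStar' (hA 4 (by norm_num) g hg.1).1.2 hm2 hg

/-- `ν*(0, g) = ν_c(g)` ("since `χ(g, ν*) ↑ ∞` as `m² ↓ 0`, it follows from the continuity of
`ν*` that `ν_c(g) = ν*(0,g)`"), relative to the clause `χ(g,ν) < ∞ ↔ ν > ν_c(g)` of Lemma A.1 for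
this `g`. [cite: BauerschmidtBrydgesSlade2015LogCorr, Proposition 4.2 (proof of (i), display ν_c(g) = ν*(0,g)) and Lemma A.1] -/
theorem nuStar_zero' (hD : Thm41Data δ K ν₀c z₀c c) {g : ℝ}
    (hiff : ∀ ν : ℝ, susceptibility 4 g ν < ∞ ↔ criticalNu 4 g < ν)
    (hg : g ∈ Ioc 0 (gStar δ K / 2)) : nuStar hD 0 g = criticalNu 4 g := by
  have h0 : (0:ℝ) ∈ Ico 0 δ := ⟨le_rfl, hD.pos⟩
  have hcont : ContinuousWithinAt (fun m2 => nuStar hD m2 g) (Ico 0 δ) 0 :=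
    hD.continuousOn_nuStar ⟨hg.1.le, hg.2⟩ 0 h0
  have hle : 𝓝[>] (0:ℝ) ≤ 𝓝[Ico 0 δ] 0 := by
    rw [← nhdsWithin_Ioo_eq_nhdsGT hD.pos]
    exact nhdsWithin_mono _ Ioo_subset_Ico_self
  have htend : Tendsto (fun m2 => nuStar hD m2 g) (𝓝[>] 0) (𝓝 (nuStar hD 0 g)) :=
    hcont.tendsto.mono_left hle
  have hev : ∀ᶠ m2 in 𝓝[>] (0:ℝ), m2 ∈ Ioo 0 δ := Ioo_mem_nhdsGT hD.pos
  apply le_antisymm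
  · refine le_of_not_gt fun hlt => ?_
    set ν' : ℝ := (criticalNu 4 g + nuStar hD 0 g) / 2 with hν'
    have hν'c : criticalNu 4 g < ν' := by rw [hν']; linarith
    have hν'lt : ν' < nuStar hD 0 g := by rw [hν']; linarith
    have hfin : susceptibility 4 g ν' < ∞ := (hiff ν').2 hν'c
    set C : ℝ := (susceptibility 4 g ν').toReal with hC
    have hC0 : 0 ≤ C := ENNReal.toReal_nonneg
    have hev2 : ∀ᶠ m2 in 𝓝[>] (0:ℝ), ν' < nuStar hD m2 g := htend.eventually (lt_mem_nhds hν'lt)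
    have hev3 : ∀ᶠ m2 in 𝓝[>] (0:ℝ), m2 ∈ Ioo 0 (7 / (8 * (C + 1))) :=
      Ioo_mem_nhdsGT (by positivity)
    obtain ⟨m, hm, hm2, hm3⟩ := (hev.and (hev2.and hev3)).exists
    have hχ := hD.susceptibility_nuStar hm hg
    have hmono := susceptibility_antitone 4 g hm2.le
    have hle' : (susceptibility 4 g (nuStar hD m g)).toReal ≤ C := ENNReal.toReal_mono hfin.ne hmono
    rw [hχ] at hle'
    have hr := (hD.gRoot_spec ⟨hm.1.le, hm.2⟩ ⟨hg.1.le, hg.2⟩).1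
    have hz := (hD.one_add_z₀c_mem ⟨hm.1.le, hm.2⟩ hr.1 hr.2).1
    have h78 : (7 / 8 : ℝ) / m ≤ C := (div_le_div_of_nonneg_right hz hm.1.le).trans hle'
    rw [div_le_iff₀ hm.1] at h78
    have hm3' := hm3.2
    rw [lt_div_iff₀ (by positivity)] at hm3'
    nlinarith
  · exact ge_of_tendsto htend (hev.mono fun m hm => (hD.criticalNu_lt_nuStar' hiff hm hg).le)

/-- `ν*(0, g) = ν_c(g)` ("since `χ(g, ν*) ↑ ∞` as `m² ↓ 0`, it follows from the continuity of
`ν*` that `ν_c(g) = ν*(0,g)`"). [cite: BauerschmidtBrydgesSlade2015LogCorr, Proposition 4.2 (proof of (i), display ν_c(g) = ν*(0,g))] -/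
theorem nuStar_zero (hD : Thm41Data δ K ν₀c z₀c c) (hA : BBS2015_lemA1) {g : ℝ}
    (hg : g ∈ Ioc 0 (gStar δ K / 2)) : nuStar hD 0 g = criticalNu 4 g :=
  hD.nuStar_zero' (hA 4 (by norm_num) g hg.1).1.2 hg

end Thm41Data

/-! ### Proposition 4.2(ii) from Theorem 4.1 and Lemma A.1 -/

/-- **Proposition 4.2(ii) from Theorem 4.1's conclusions and the clause `χ(g,ν) < ∞ ↔ ν > ν_c(g)`
of Lemma A.1** (at `d = 4`, for every `g > 0`; the only input from Lemma A.1 that the printed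
proof uses) — the source's proof of Proposition 4.2 ("the construction of the maps … involves only
elementary calculus … the identification of the critical point … uses `χ = (1+z₀)χ̂ = (1+z₀)/m²`"),
PROVED: `g₀*` is the inverse of `s(m², ·) = ·/(1 + z₀ᶜ(m², ·))²` on `[0, g_*]`,
`ν*(m², g) = (ν₀* + m²)/(1 + z₀*)`, `ν*(m², g) > ν_c(g)` for `m² > 0` and `ν*(0, g) = ν_c(g)`
(this is where `χ < ∞ ↔ ν > ν_c` enters), `m̃²(g, ε) = inf{m² : ν*(m², g) = ν_c(g) + ε}`
(attained; nonempty for `ε < ε₁(g) = ν*(δ/2, g) - ν_c(g)` by the intermediate value theorem),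
`m̃² → 0` as `ε ↓ 0` (positive minimum of `ν* - ν_c` on `[η, δ/2]`), `g̃₀ = g₀*(m̃², g)`.
[cite: BauerschmidtBrydgesSlade2015LogCorr, Proposition 4.2 (proof) and Lemma A.1] -/
theorem BBS2015_prop42ii_of_lt_top_iff
    (hiff : ∀ g : ℝ, 0 < g → ∀ ν : ℝ, susceptibility 4 g ν < ∞ ↔ criticalNu 4 g < ν) :
    BBS2015_prop42ii := by
  intro δ K ν₀c z₀c c hD
  refine ⟨gStar δ K / 2, 5 * K + 1, half_pos hD.gStar_pos, fun g hg => ?_⟩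
  have hK := hD.K_nonneg
  have hg' : g ∈ Ioc 0 (gStar δ K / 2) := ⟨hg.1, hg.2.le⟩
  have hgI : g ∈ Icc 0 (gStar δ K / 2) := ⟨hg.1.le, hg.2.le⟩
  set f : ℝ → ℝ := fun m2 => nuStar hD m2 g with hf
  set ν_c : ℝ := criticalNu 4 g with hν_c
  set m₁ : ℝ := δ / 2 with hm₁def
  have hm₁ : m₁ ∈ Ioo 0 δ := ⟨by rw [hm₁def]; linarith [hD.pos], by rw [hm₁def]; linarith [hD.pos]⟩
  have hf0 : f 0 = ν_c := hD.nuStar_zero' (hiff g hg.1) hg'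
  have hfcont : ContinuousOn f (Icc 0 m₁) :=
    (hD.continuousOn_nuStar hgI).mono (Icc_subset_Ico_right hm₁.2)
  have hfgt : ∀ m ∈ Ioc 0 m₁, ν_c < f m := fun m hm =>
    hD.criticalNu_lt_nuStar' (hiff g hg.1) ⟨hm.1, hm.2.trans_lt hm₁.2⟩ hg'
  set ε₁ : ℝ := f m₁ - ν_c with hε₁
  have hε₁pos : 0 < ε₁ := sub_pos.2 (hfgt m₁ ⟨hm₁.1, le_rfl⟩)
  -- level sets of `ν*(·, g)` and `m̃²`
  set S : ℝ → Set ℝ := fun ε => Icc 0 m₁ ∩ f ⁻¹' {ν_c + ε} with hS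
  set mt : ℝ → ℝ := fun ε => sInf (S ε) with hmt
  have hSclosed : ∀ ε, IsClosed (S ε) := fun ε =>
    hfcont.preimage_isClosed_of_isClosed isClosed_Icc isClosed_singleton
  have hSbdd : ∀ ε, BddBelow (S ε) := fun ε => ⟨0, fun m hm => hm.1.1⟩
  have hSne : ∀ ε ∈ Ico (0:ℝ) ε₁, (S ε).Nonempty := by
    intro ε hε
    have hmem : ν_c + ε ∈ Icc (f 0) (f m₁) := by
      rw [hf0]
      constructor <;> linarith [hε.1, hε.2]
    obtain ⟨m, hm, hfm⟩ := intermediate_value_Icc hm₁.1.le hfcont hmem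
    exact ⟨m, hm, hfm⟩
  have hmt_mem : ∀ ε ∈ Ico (0:ℝ) ε₁, mt ε ∈ S ε := fun ε hε =>
    (hSclosed ε).csInf_mem (hSne ε hε) (hSbdd ε)
  have hmt_val : ∀ ε ∈ Ico (0:ℝ) ε₁, f (mt ε) = ν_c + ε := fun ε hε => (hmt_mem ε hε).2
  have hmt_Icc : ∀ ε ∈ Ico (0:ℝ) ε₁, mt ε ∈ Icc 0 m₁ := fun ε hε => (hmt_mem ε hε).1
  have hmt0 : mt 0 = 0 := by
    have h0S : (0:ℝ) ∈ S 0 := ⟨⟨le_rfl, hm₁.1.le⟩, by simp [hf0]⟩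
    exact le_antisymm (csInf_le (hSbdd 0) h0S) (le_csInf ⟨0, h0S⟩ fun m hm => hm.1.1)
  have hmt_pos : ∀ ε ∈ Ioo (0:ℝ) ε₁, 0 < mt ε := by
    intro ε hε
    have h0 := (hmt_Icc ε ⟨hε.1.le, hε.2⟩).1
    rcases h0.eq_or_lt with h | h
    · exfalso
      have := hmt_val ε ⟨hε.1.le, hε.2⟩
      rw [← h, hf0] at this
      linarith [hε.1]
    · exact h
  -- right-continuity of `m̃²` at `ε = 0`
  have hmt_cont : ContinuousWithinAt mt (Ici 0) 0 := by
    rw [Metric.continuousWithinAt_iff]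
    intro η hη
    set η' : ℝ := min (η / 2) m₁ with hη'
    have hη'pos : 0 < η' := lt_min (half_pos hη) hm₁.1
    have hJne : (Icc η' m₁).Nonempty := nonempty_Icc.2 (min_le_right _ _)
    have hcontJ : ContinuousOn (fun m => f m - ν_c) (Icc η' m₁) :=
      (hfcont.mono (Icc_subset_Icc hη'pos.le le_rfl)).sub continuousOn_const
    obtain ⟨m₀, hm₀, hmin⟩ := isCompact_Icc.exists_isMinOn hJne hcontJ
    have hθ : 0 < f m₀ - ν_c := sub_pos.2 (hfgt m₀ ⟨hη'pos.trans_le hm₀.1, hm₀.2⟩)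
    refine ⟨min (f m₀ - ν_c) ε₁, lt_min hθ hε₁pos, fun ε hε hdist => ?_⟩
    rw [dist_zero_right, Real.norm_eq_abs, abs_of_nonneg (show (0:ℝ) ≤ ε from hε)] at hdist
    have hε' : ε ∈ Ico (0:ℝ) ε₁ := ⟨hε, hdist.trans_le (min_le_right _ _)⟩
    have hlt : mt ε < η' := by
      refine lt_of_not_ge fun hge => ?_
      have hmem : mt ε ∈ Icc η' m₁ := ⟨hge, (hmt_Icc ε hε').2⟩
      have h1 : f m₀ - ν_c ≤ f (mt ε) - ν_c := hmin hmem
      rw [hmt_val ε hε'] at h1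
      linarith [hdist.trans_le (min_le_left _ _)]
    rw [hmt0, Real.dist_eq, sub_zero, abs_of_nonneg (hmt_Icc ε hε').1]
    linarith [min_le_left (η / 2) m₁]
  -- `g̃₀ = g₀*(m̃², g)`
  set gt : ℝ → ℝ := fun ε => gRoot hD (mt ε) g with hgt
  have hgt_cont : ContinuousWithinAt gt (Ici 0) 0 := by
    have hroot_cont : ContinuousWithinAt (fun m2 => gRoot hD m2 g) (Ico 0 δ) 0 :=
      hD.continuousOn_gRoot hgI 0 ⟨le_rfl, hD.pos⟩
    have hmt_tend : Tendsto mt (𝓝[Ici 0] 0) (𝓝[Ico 0 δ] 0) := by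
      refine tendsto_nhdsWithin_iff.2 ⟨?_, ?_⟩
      · have h := hmt_cont.tendsto
        rwa [hmt0] at h
      · filter_upwards [Ico_mem_nhdsGE hε₁pos] with ε hε
        exact ⟨(hmt_Icc ε hε).1, (hmt_Icc ε hε).2.trans_lt hm₁.2⟩
    have h := hroot_cont.tendsto.comp hmt_tend
    have h' : gt 0 = gRoot hD 0 g := by simp [hgt, hmt0]
    rw [ContinuousWithinAt, h']
    exact h
  refine ⟨ε₁, hε₁pos, mt, gt, hmt0, hmt_cont, hgt_cont, hmt_pos, fun ε hε => ?_⟩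
  have hmI : mt ε ∈ Ico 0 δ := ⟨(hmt_Icc ε hε).1, (hmt_Icc ε hε).2.trans_lt hm₁.2⟩
  obtain ⟨hr, hs⟩ := hD.gRoot_spec hmI hgI
  have hrpos : 0 < gt ε := hD.gRoot_pos hmI hg'
  obtain ⟨hz1, hz2⟩ : 7 / 8 ≤ 1 + z₀c (mt ε) (gt ε) ∧ 1 + z₀c (mt ε) (gt ε) ≤ 9 / 8 :=
    hD.one_add_z₀c_mem hmI hr.1 hr.2
  have hzne : 1 + z₀c (mt ε) (gt ε) ≠ 0 := by linarith
  have hrI : gt ε ∈ Ico 0 δ := ⟨hr.1, hr.2.trans_lt hD.gStar_lt_delta⟩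
  have hzabs : |z₀c (mt ε) (gt ε)| ≤ K * gt ε := hD.abs_z₀c_le hmI hrI
  have hνabs : |ν₀c (mt ε) (gt ε)| ≤ K * gt ε := hD.abs_ν₀c_le hmI hrI
  have hs' : gt ε / (1 + z₀c (mt ε) (gt ε)) ^ 2 = g := hs
  have hgt_eq : gt ε = g * (1 + z₀c (mt ε) (gt ε)) ^ 2 := by
    rw [← hs']
    field_simp
  have hgt_le : gt ε ≤ 2 * g := by
    have hsq : (1 + z₀c (mt ε) (gt ε)) ^ 2 ≤ 81 / 64 := by nlinarith
    have := mul_le_mul_of_nonneg_left hsq hg.1.le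
    linarith
  have hKgt : K * gt ε ≤ 1 / 8 := hD.K_mul_le_of_le_gStar hr.1 hr.2
  refine ⟨(hmt_Icc ε hε).2.trans_lt hm₁.2, ⟨hrpos, hrI.2⟩, ?_, ?_, ?_, hs'.symm, ?_⟩
  · -- `g̃₀ = g + O(g²)`
    have hzb := abs_le.1 hzabs
    have h1 : gt ε - g = g * (z₀c (mt ε) (gt ε) * (2 + z₀c (mt ε) (gt ε))) := by
      linear_combination hgt_eq
    rw [h1, abs_mul, abs_of_pos hg.1, abs_mul]
    have h2 : |z₀c (mt ε) (gt ε)| ≤ 2 * K * g := hzabs.trans (by nlinarith)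
    have h3 : |2 + z₀c (mt ε) (gt ε)| ≤ 17 / 8 := by
      rw [abs_le]; constructor <;> linarith
    calc g * (|z₀c (mt ε) (gt ε)| * |2 + z₀c (mt ε) (gt ε)|) ≤ g * (2 * K * g * (17 / 8)) :=
          mul_le_mul_of_nonneg_left
            (mul_le_mul h2 h3 (abs_nonneg _) (mul_nonneg (mul_nonneg (by norm_num) hK) hg.1.le))
            hg.1.le
      _ ≤ (5 * K + 1) * g ^ 2 := by nlinarith [hg.1]
  · exact hνabs.trans (by nlinarith)
  · exact hzabs.trans (by nlinarith)
  · have := hmt_val ε hε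
    simpa [hf, nuStar] using this.symm

/-- **Proposition 4.2(ii) from Theorem 4.1's conclusions and Lemma A.1** (`BBS2015_lemA1`, of
which only the clause `χ(g,ν) < ∞ ↔ ν > ν_c(g)` at `d = 4` is used:
`BBS2015_prop42ii_of_lt_top_iff`). [cite: BauerschmidtBrydgesSlade2015LogCorr, Proposition 4.2 (proof)] -/
theorem BBS2015_prop42ii_of_lemA1 (hA : BBS2015_lemA1) : BBS2015_prop42ii :=
  BBS2015_prop42ii_of_lt_top_iff fun g hg ν => (hA 4 (by norm_num) g hg).1.2 ν

end ChangeOfParameters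

/-- **Theorem 1.1 from Theorem 4.1, Lemma A.1, Lemma 2.1 (part) and (1.8)**: the reduction
`BBS2015_thm11_of_thm41` with its Proposition-4.2(ii) input discharged by
`BBS2015_prop42ii_of_lemA1`. [cite: BauerschmidtBrydgesSlade2015LogCorr, §4.2–§4.3] -/
theorem BBS2015_thm11_of_thm41_of_lemA1 (h41 : BBS2015_thm41) (hA : BBS2015_lemA1)
    (h21 : BBS2015_lem21) (h18 : BBS2015_eq18) : BBS2015_thm11 :=
  BBS2015_thm11_of_thm41 h41 (BBS2015_prop42ii_of_lemA1 hA) h21 h18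

end CTWSAW

/-- The barrier `WeaklySAWFourDimLogCorrections` from Theorem 4.1, Lemma A.1, Lemma 2.1 (part)
and (1.8) of the source. [cite: BauerschmidtBrydgesSlade2015LogCorr, Theorem 1.1, §4.2–§4.3] -/
theorem weaklySAWFourDimLogCorrections_of_thm41_of_lemA1 (h41 : CTWSAW.BBS2015_thm41)
    (hA : CTWSAW.BBS2015_lemA1) (h21 : CTWSAW.BBS2015_lem21) (h18 : CTWSAW.BBS2015_eq18) :
    WeaklySAWFourDimLogCorrections :=
  CTWSAW.BBS2015_thm11_of_thm41_of_lemA1 h41 hA h21 h18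

end Literature.Barriers.CriticalPhenomena
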